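import Literature.MathematicalPhysics.QuantumFieldTheory.Balaban1983to89.B9Thm34HolderAllFinal
import Literature.MathematicalPhysics.QuantumFieldTheory.Balaban1983to89.B9Thm34HolderLeftFinal
import Literature.MathematicalPhysics.QuantumFieldTheory.Balaban1983to89.B9Thm34GUniformR1
import Literature.MathematicalPhysics.QuantumFieldTheory.Balaban1983to89.B9Thm34POneUniformR1

/-!
# `Balaban1983to89.B9Thm34HolderGClauseUniformR1` — [Balaban1985BackgroundPropagators] THEOREM 3.4 × THEOREM 3.3, THE (3.43)-TYPE HÖLDER
# MEMBERS OF `G(U′U)` (DERIVATIVE ON THE LEFT AND ON THE RIGHT), CONSTANTS BEFORE THE LATTICE, ON r06's KERNEL-FREE G-CLAUSE — r06 FILE 55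
# `B9Thm34HolderAllUniform.thm34_all_holder_uniform` (G parts (iii), (iv)) RE-RUN ON `B9Thm34GUniformR1.thm34_G_clause_uniform` INSTEAD OF
# `B9Thm34AllUniform.thm34_all_uniform`: NO KERNEL-FORM LETTER OF G(U), and the R1 binders (pub-ymgap N06 row 13, step 13-H1(G))

statement-level skeleton of published theorems with citation tags; proofs where landed; nothing here is a claim about the Yang–Mills mass gap

CITATION HEADER (lean-in-tree rule).  B9 = T. Bałaban, *Propagators for lattice gauge theories in a background field*, Commun. Math. Phys.
**99** (1985) 389–434 [Balaban1985BackgroundPropagators] (held `paper:balaban1985-cmp99-background-propagators`; journal page = PDF page + 388):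
Theorem 3.4 p. 400 [PDF 12] L7–10 «The extended operators satisfy all the inequalities of Theorems 3.1–3.3 correspondingly»; Theorem 3.3 p. 399
[PDF 11] «with G′(U) replaced by G(U) and λ replaced by a function J defined at bonds of the lattice»; (3.43) p. 398 [PDF 10] «‖ζ∇_UG′(U)λ‖_β,
‖ζG′(U)∇*_Uλ‖_β ≦ B₀(β₀)(Lʲη)^{1−β}·(‖ζ‖_β^ξ + |ζ|)e^{−δ₀d(y,y′)}|λ|»; (3.40) p. 397; p. 399 L1–3 «the constants … do not depend on the sequence
{Ω_j}»; p. 403 [PDF 15] l. 1–9 «… of course with different constants»; (3.76)–(3.77) pp. 405–406; (3.82)–(3.86) p. 407 [PDF 19].  [4] =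
[Balaban1984PropagatorsII] (2.51)–(2.55) p. 232; Lemma 2.1 p. 234 with (2.59) p. 233.  [Balaban1985Variational] (135) p. 298 (the (3.35) reading).
Rows B9.Thm3.4 × B9.Thm3.3 ((3.43) cells) × B9.Eq3.76–3.86 × B6.Lemma2.1 (cells only; no row head changes).

WHY THIS FILE (pub-ymgap N06 row 13, seat dag-n06-c gen 6; `GSIDE-L2-SPEC.md` §G; sibling of `B9SectBGHolderLeftAtLetters`).  r06's FILE 55
proves the four (3.43) members of the extended operators with ONE threshold and ONE constant before the lattice, but obtains its `G(U′U)` from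
FILE 54 §2 `thm34_all_holderLeft_uniform`, i.e. from `B9Thm34AllUniform.thm34_all_uniform` and its KERNEL-FORM letters of G(U) (`HasKernelBound`),
which the lit-balaban desk (pub-ymgap ME #13, 2026-08-26) records as not satisfied by Bałaban's own propagators on multi-point blocks — no genuine
instance can call it.  The kernel letters are IDLE in the G-side Hölder members: the pair `C⁻¹(U′U), G(U′U)`, its identities and the left-entry
clause come kernel-free from `B9Thm34GUniformR1.thm34_G_clause_uniform`; the Hölder-LEFT members are `B9Thm34HolderLeftFinal.norm_probe_transfer` on
that clause; the Hölder-RIGHT member is FILE 35 `B9Thm34HolderRightG.thm34_G_holderRight_concreteV₃` (kernel-free, per lattice at literal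
exponents) with (3.77) from the R1 twin `B9Thm34POneUniformR1.exists_threshold_pOne_uniform`, the two `C⁻¹(U′U)` and the two `G(U′U)` identified by
uniqueness of two-sided inverses — FILE 55's own device.  THIS FILE is that re-run, with the [4] Lemma 2.1 / scale-transfer binders in the R1
shape `9/5000 ≤ α` (the shape the row-13 frames' fields supply).

WHAT IS PROVED (1 theorem: 0 `def`, 0 sorry, 0 new named facts; standard axioms):
* ★★ **`thm34_G_holder_clause_uniform`** — hypotheses = `B9Thm34GUniformR1.thm34_G_clause_uniform`'s VERBATIM plus the lattice-free `0 < B₀`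
  (NO kernel-form letter); conclusion `∃ a₁ > 0 ∃ B ≧ 0 ∀ (lattice, background, letters, section, Theorems 3.1–3.3 for U as block majorants)
  ∀ α₁ ≦ a₁ ∀ A ∈ (3.37) ∀ (3.57)/(3.59) letters ∀ (3.80)–(3.82) letters ∃ C⁻¹(U′U), G(U′U)`: the four defining identities (re-exported); (L) the
  left-entry clause `X·G(U) ≺ B₀Pe^{−δ₀d} ⟹ X·G(U′U) ≺ BPe^{−(δ₀/6)d}`; (R) the right-entry clause; (iii) the (3.43)-type Hölder members with
  the derivative ON THE LEFT per probe: `‖Φ(DG(U)μ)‖ ≦ B_h(Lʲη)^{1−β}c_ζe^{−δ₀d(y,y′)}|μ|` (all block-supported `μ`) ⟹ `‖Φ(DG(U′U)μ)‖ ≦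
  B·B_h(Lʲη)^{1−β}c_ζe^{−(δ₀/6)d(y,y′)}|μ|`; (iv) the (3.43)-type member with the derivative (any right letter `D_s` with `G(U)D_s ≺ B₀Lʲηe^{−δ₀d}`)
  ON THE RIGHT per probe, from the inputs (a) `‖Φ(G(U)J)‖ ≦ B_h(Lʲη)^{2−γ}c_ζe^{−δ₀d}|J|`, (b) `‖Φ(G(U)∇_kJ)‖ ≦ B_h(Lʲη)^{1−γ}c_ζe^{−δ₀d}|J|`,
  (c) the same for `G(U)D_s`: `‖Φ(G(U′U)D_sJ)‖ ≦ B·B_h(Lʲη)^{1−γ}c_ζe^{−(δ₀/6)d(y,y′)}|J|` — FILE 55 (iii)/(iv) verbatim in shape.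

PROOF.  FILE 55's proof with the two callee swaps named above (scripted from the tree text; the cascade arithmetic, the smallness threshold
`exists_threshold_of_continuousAt`, the clause-constant bound `exists_bound_of_continuousAt`, (3.83) `ineq383_op`, (3.76) `eq376_concrete`, FILE 35,
`left_inv_eq_right_inv`, `holderBound_const_mono` ∕ `holderBound_rate_mono` — all BY NAME, verbatim); (iii) by `norm_probe_transfer`.

HONEST SCOPE / NOT CLAIMED.  As FILE 55 (module header there): Theorems 3.1/3.3 FOR `U` enter per functional as the inputs of each clause;
`Φ` arbitrary (the instance takes the transported Hölder quotients (3.40) with cut-offs); rates `δ₀ → δ₀/6` one admissible choice («with different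
constants», p. 403); 9/5000 and the cascade exponents are proof constants of the r06 chain, not printed numbers.  Nothing of [B9] is asserted; no
row head changes; NOT a node discharge; nothing continuum / OS / mass-gap / Clay.  Cell `pub-ymgap` (HUMAN RULING D-0062), Track A node N06 [B9],
N06-ASSIGNMENT row 13, seat `pub-ymgap-dag-n06-c` (g6), 2026-08-27.  Count-neutral.

RELATED IN THE TREE, NOT DUPLICATED (searched 2026-08-27: `lean search 'holder_clause_uniform' --decl` = ∅): FILE 55 `B9Thm34HolderAllUniform`
(kernel-form statement; kept — it has importers), FILE 36 `B9Thm34HolderAllFinal` (`holderBound_const_mono`, `holderBound_rate_mono`), FILE 35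
`B9Thm34HolderRightG`, `B9Thm34GUniformR1`, `B9Thm34POneUniformR1`, `B9Thm34HolderLeftFinal.norm_probe_transfer`, Mathlib's `left_inv_eq_right_inv`
— all USED BY NAME; no existing module modified.
-/

noncomputable section

namespace Literature.MathematicalPhysics.QuantumFieldTheory.Balaban1983to89.B9Thm34HolderGClauseUniformR1

open NormedSpace Complex
open Literature.MathematicalPhysics.QuantumFieldTheory.Balaban1983to89
open Literature.MathematicalPhysics.QuantumFieldTheory.Balaban1983to89.B6RandomWalk (HasMajorant BlockSupp hasMajorant_mono Triangle254 Ineq261)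
open Literature.MathematicalPhysics.QuantumFieldTheory.Balaban1983to89.B6RandomWalkHom (HasMajorantHom)
open Literature.MathematicalPhysics.QuantumFieldTheory.Balaban1983to89.B6RandomWalkSection (secExt secRes secConj)
open Literature.MathematicalPhysics.QuantumFieldTheory.Balaban1983to89.B9Thm34Ext (toB6)
open Literature.MathematicalPhysics.QuantumFieldTheory.Balaban1983to89.B9Ineq347 (ScaleTransfer)
open Literature.MathematicalPhysics.QuantumFieldTheory.Balaban1983to89.B9Eq386Neumann (pTwo deltaA)
open Literature.MathematicalPhysics.QuantumFieldTheory.Balaban1983to89.B9Eq39Adjoint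
open Literature.MathematicalPhysics.QuantumFieldTheory.Balaban1983to89.B9Eq369Small (Through)
open Literature.MathematicalPhysics.QuantumFieldTheory.Balaban1983to89.B9Eq372Locality (stBonds)
open Literature.MathematicalPhysics.QuantumFieldTheory.Balaban1983to89.B9Eq352DivForm (tauF tauB)
open Literature.MathematicalPhysics.QuantumFieldTheory.Balaban1983to89.B9Eq352DivFormLetters
open Literature.MathematicalPhysics.QuantumFieldTheory.Balaban1983to89.B9Eq352GradLetters (diffLetter)
open Literature.MathematicalPhysics.QuantumFieldTheory.Balaban1983to89.B9Eq371GradLetters (bT bU)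
open Literature.MathematicalPhysics.QuantumFieldTheory.Balaban1983to89.B9Eq372RemLetters (lapDDLetter)
open Literature.MathematicalPhysics.QuantumFieldTheory.Balaban1983to89.B9Eq382V3Letters (dPrimeLetter)
open Literature.MathematicalPhysics.QuantumFieldTheory.Balaban1983to89.B9Eq376POneLetters (conjHom gradLin divLin eq376_concrete)
open Literature.MathematicalPhysics.QuantumFieldTheory.Balaban1983to89.B9Eq360Vprime (gPrimeExtEnd)
open Literature.MathematicalPhysics.QuantumFieldTheory.Balaban1983to89.B9Eq360VprimeLetters (vPrimeConc)
open Literature.MathematicalPhysics.QuantumFieldTheory.Balaban1983to89.B9Ineq385VG (kappa383 kappa383_nonneg kappa385 kappa385_nonneg ineq383_op)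
open Literature.MathematicalPhysics.QuantumFieldTheory.Balaban1983to89.B9Ineq385V3Concrete (cV385)
open Literature.MathematicalPhysics.QuantumFieldTheory.Balaban1983to89.B9Ineq385Kernel (exp_rate_mono)
open Literature.MathematicalPhysics.QuantumFieldTheory.Balaban1983to89.B9Ineq366CPrime (hasMajorant_rate_mono)
open Literature.MathematicalPhysics.QuantumFieldTheory.Balaban1983to89.B9Thm34GFinal (exists_threshold_of_continuousAt ineq261_rescale
  scaleTransfer_rescale c1_pos_of_ineq261)
open Literature.MathematicalPhysics.QuantumFieldTheory.Balaban1983to89.B9Thm34GKernelFinal (exists_bound_of_continuousAt)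
open Literature.MathematicalPhysics.QuantumFieldTheory.Balaban1983to89.B9Thm34HolderRightG (thm34_G_holderRight_concreteV₃)
open Literature.MathematicalPhysics.QuantumFieldTheory.Balaban1983to89.B9Thm34POneUniformR1 (exists_threshold_pOne_uniform)
open Literature.MathematicalPhysics.QuantumFieldTheory.Balaban1983to89.B9Thm34GUniformR1 (thm34_G_clause_uniform)
open Literature.MathematicalPhysics.QuantumFieldTheory.Balaban1983to89.B9Thm34HolderLeftFinal (norm_probe_transfer)
open Literature.MathematicalPhysics.QuantumFieldTheory.Balaban1983to89.B9Thm34HolderAllFinal (holderBound_const_mono holderBound_rate_mono)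


section HolderGClauseU

variable {𝔸 : Type*} [NormedRing 𝔸] [NormedAlgebra ℂ 𝔸] [CompleteSpace 𝔸] {ι : Type} [Fintype ι]
variable (b : Module.Basis ι ℝ 𝔸) (κ : Type) [Fintype κ] [LinearOrder κ]

set_option maxHeartbeats 1600000 in
/-- ★★ **THEOREM 3.4 × THEOREM 3.3 — THE (3.43)-TYPE HÖLDER MEMBERS OF `G(U′U)`, DERIVATIVE ON THE LEFT AND ON THE RIGHT, ONE THRESHOLD, ONE
CONSTANT BEFORE THE LATTICE, ON THE KERNEL-FREE G-CLAUSE** («‖ζ∇_UG′λ‖_β, ‖ζG′∇*_Uλ‖_β ≦ B₀(β₀)(Lʲη)^{1−β}(‖ζ‖_β^ξ + |ζ|)e^{−δ₀d(y,y′)}|λ|»,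
(3.43) p. 398; Theorem 3.3 p. 399 «with λ replaced by J»; for `U′U` by Theorem 3.4 p. 400; «the constants … do not depend on the sequence {Ω_j}»,
p. 399): `∃ a₁ > 0 ∃ B ≧ 0 ∀ (lattice 𝔅 = g, background U, data, Theorems 3.1–3.3 for U as BLOCK MAJORANTS — no kernel-form letter; 0 < B₀
hoisted before) ∀ α₁ ≦ a₁ ∀ A ∈ (3.37) ∀ (3.57)/(3.59) letters ∀ (3.80)–(3.82) letters ∃ C⁻¹(U′U), G(U′U)` (r06's kernel-free pair of
`B9Thm34GUniformR1.thm34_G_clause_uniform`, identities re-exported) with (L)/(R) the two entry clauses at `(B, δ₀/6)`, (iii) the Hölder-left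
members per probe at `(B, δ₀/6)` and (iv) the Hölder-right member per probe at `(B, δ₀/6)` (inputs (a)–(c) per right letter `D_s` and
functional `Φ`) — r06 FILE 55 (iii)/(iv) re-run on the kernel-free clause; R1 binders.
[cite: Balaban1985BackgroundPropagators, Thm 3.4 p.400 + p.399 + Thm 3.1 (3.40)/(3.42)–(3.43) pp.397–398 + Thm 3.3 p.399 + (3.62)–(3.65) pp.402–403 + p.403 l.1–9 + (3.76)–(3.77) pp.405–406 + (3.82)–(3.86) p.407 + (3.37)/(3.35) p.396; Balaban1984PropagatorsII, (2.51)–(2.55) p.232 + Lemma 2.1 p.234; Balaban1985Variational, (135) p.298] -/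
theorem thm34_G_holder_clause_uniform [DecidableEq ι] (d : ℕ)
    (δ₀ B₀ κQ BG B₁ cF Cq a₀ C₀ d₀ M₂ κQb cFb abar : ℝ) (Λf : ℝ → ℝ)
    (hB₀ : 0 ≤ B₀) (hκQ : 0 < κQ) (hBG : 0 < BG) (hB₁ : 0 < B₁) (hcF : 0 < cF) (hCq : 0 ≤ Cq) (ha₀ : 0 ≤ a₀) (hC₀ : 0 ≤ C₀)
    (hM₂ : 0 ≤ M₂) (hδ₀ : 0 < δ₀) (hκQb : 0 ≤ κQb) (hcFb : 0 ≤ cFb) (habar : 0 ≤ abar) (hΛf : ∀ α : ℝ, 0 < α → 1 ≤ Λf α) (hB₀' : 0 < B₀)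
    (hrepr : ∀ (v : 𝔸) (i : ι), |b.repr v i| ≤ M₂ * ‖v‖) :
    ∃ a₁ : ℝ, 0 < a₁ ∧ ∃ B : ℝ, 0 ≤ B ∧
    ∀ {S : Type} [Fintype S] [DecidableEq S] (T : κ → Equiv.Perm S) (U : κ → S → 𝔸ˣ)
      {g : B9.Geometry} [Fintype g.Site] [DecidableEq g.Site] [Nonempty g.Site] {Rr : ℝ} {H : Prop} (blk : S → g.Site)
      (kQ : g.Site → S → 𝔸 →L[ℝ] 𝔸) (sQ : S → 𝔸 →L[ℝ] 𝔸) (cfun w : g.Site → ℝ)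
    -- the multiscale geometry 𝔅 (p. 393, [4] (2.1)–(2.4)) and its axioms
    (hdnn : ∀ a a' : g.Site, 0 ≤ g.dist a a') (htri : Triangle254 (toB6 g Rr H)) (hrefl : ∀ y : g.Site, g.dist y y = 0)
    (hsym : ∀ y y' : g.Site, g.dist y y' = g.dist y' y) (hlen : ∀ y : g.Site, 0 < g.len y) (hlenη : ∀ y : g.Site, g.eta ≤ g.len y)
    (hη : 0 < g.eta) (hL : 1 ≤ g.L)
    -- [4] Lemma 2.1 (2.61) at the rate `δ₀`, for every exponent `9/5000 ≤ α < 1` (R1: the exponents the proof uses; print: «0 < α < 1» with (2.59))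
    (h261 : ∀ α : ℝ, 9 / 5000 ≤ α → α < 1 → Ineq261 d (toB6 g Rr H) δ₀ α)
    -- p. 398: «Using Lemma 2.1 in [4] we may replace the factor (Lʲη)^α by (Lʲη)^β(L^{j′}η)^γ with β + γ = α» — for every exponent
    -- `9/5000 ≤ α` (R1), one constant `Λ(α) ≧ 1` for the six weights `(Lʲη)^{1,2,−1,−2,−4}` (natural and real powers)
      (hST : ∀ α : ℝ, 9 / 5000 ≤ α → ScaleTransfer g δ₀ α (Λf α) (fun a => g.len a) ∧ ScaleTransfer g δ₀ α (Λf α) (fun a => g.len a ^ 2) ∧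
        ScaleTransfer g δ₀ α (Λf α) (fun a => (g.len a)⁻¹) ∧ ScaleTransfer g δ₀ α (Λf α) (fun a => (g.len a ^ 2)⁻¹) ∧
        ScaleTransfer g δ₀ α (Λf α) (fun a => (g.len a ^ 4)⁻¹) ∧ ScaleTransfer g δ₀ α (Λf α) (fun y => g.len y ^ (-(4 : ℝ))))
    -- real coordinates of `𝔸`, commuting translations, unitary-type background
    (hT : ∀ (μ ν : κ) (x : S), T μ (T ν x) = T ν (T μ x))
    (hU1 : ∀ m z, ‖((U m z : 𝔸ˣ) : 𝔸)‖ ≤ 1 ∧ ‖(((U m z)⁻¹ : 𝔸ˣ) : 𝔸)‖ ≤ 1)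
    -- (3.35) on the plaquettes through each bond, at that bond's block scale; stencil geometry at range `d₀`
    (h35 : ∀ μ x m n y, Through T μ x m n y → ‖(plaqU T U m n y : 𝔸) - 1‖ ≤ C₀ * ((g.L ^ g.scale (blk x))⁻¹) ^ 2)
    (hd₀B : ∀ μ x, g.dist (blk x) (blk ((T μ).symm x)) ≤ d₀) (hd₀F : ∀ μ x, g.dist (blk x) (blk (T μ x)) ≤ d₀)
    (hd₀FB : ∀ μ ν x, g.dist (blk x) (blk ((T ν).symm (T μ x))) ≤ d₀)
    (hd₀st : ∀ μ x (q : κ × S), q ∈ stBonds T μ x → g.dist (blk x) (blk q.2) ≤ d₀)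
    (hd₀loc : ∀ μ x (q : κ × S), q ∈ B9Eq375Locality.locBondsA' T μ x → g.dist (blk x) (blk q.2) ≤ d₀)
    (hd₀0 : ∀ y : g.Site, g.dist y y ≤ d₀)
    -- the `A`-independent data of the concrete `V′(A)` of (3.60): (3.19) kernels/multipliers and the `a`-weights of (3.24)
    (hw : ∀ y, 0 ≤ w y) (hcard : ∀ y, ((B9Eq360Vprime.block blk y).card : ℝ) * w y ≤ 1)
    (hkQ : ∀ y x, blk x = y → ‖kQ y x‖ ≤ w y) (hsQ : ∀ x, ‖sQ x‖ ≤ 1) (hcfun : ∀ y, |cfun y| ≤ a₀ * (g.len y ^ 2)⁻¹)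
    -- THEOREM 3.1 for `G′(U)`: (3.42)₁,₂,₃ at the rate `δ₀`
    {Gp : Module.End ℝ (S × ι → ℝ)}
    (h342_1 : HasMajorant (g := toB6 g Rr H) (fun p : S × ι => blk p.1) Gp
      (fun a a' => BG * g.len a ^ 2 * Real.exp (-(δ₀ * g.dist a a'))))
    (h342_2 : ∀ k : κ ⊕ κ, HasMajorant (g := toB6 g Rr H) (fun p : S × ι => blk p.1)
      (conj b (diffLetter T U ((g.eta : ℂ)⁻¹) k) * Gp) (fun a a' => BG * g.len a * Real.exp (-(δ₀ * g.dist a a'))))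
    (h342_3 : ∀ k : κ ⊕ κ, HasMajorant (g := toB6 g Rr H) (fun p : S × ι => blk p.1)
      (Gp * conj b (diffLetter T U ((g.eta : ℂ)⁻¹) k)) (fun a a' => BG * g.len a * Real.exp (-(δ₀ * g.dist a a'))))
    -- the (3.19) letters `Q′(U)`, `Q′*(U)` in their own typing with block-local two-space majorants, a section of the block map (FILE 17)
    (rep : g.Site → S × ι) (hrep : ∀ y : g.Site, blk (rep y).1 = y)
    {Qc : (S × ι → ℝ) →ₗ[ℝ] (g.Site → ℝ)} {Qcs : (g.Site → ℝ) →ₗ[ℝ] (S × ι → ℝ)} {Linv : Module.End ℝ (g.Site → ℝ)}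
    (hQc : HasMajorantHom (g := toB6 g Rr H) (fun p : S × ι => blk p.1) (fun y : g.Site => y) Qc
      (fun a a' : g.Site => κQ * (if a = a' then (1 : ℝ) else 0)))
    (hQcs : HasMajorantHom (g := toB6 g Rr H) (fun y : g.Site => y) (fun p : S × ι => blk p.1) Qcs
      (fun a a' : g.Site => κQ * (if a = a' then (1 : ℝ) else 0)))
    -- THEOREM 3.2 for `U`: (3.21) `C⁻¹ = (Q′G′²Q′*)⁻¹` exists (`hLinv`) with the KERNEL bound (3.48) at the rate `δ₀`
    (hLinv : (Qc ∘ₗ (Gp * Gp) ∘ₗ Qcs) * Linv = 1)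
    (h348 : ∀ y y' : g.Site, |B9Thm34Inv.ker (B9Thm34Inv.vol g d) Linv y y'| ≤
      B₁ * g.len y ^ (-(4 : ℝ)) * g.len y' ^ (-(d : ℝ)) * Real.exp (-(δ₀ * g.dist y y')))
    -- the (3.15) bond letters `Q(U)`, `Q*(U)` and the weight letter `a` of (3.24)/(3.26), with their majorants
    {G Qs Q a : Module.End ℝ ((κ × S) × ι → ℝ)}
    (hQb : HasMajorant (g := toB6 g Rr H) (fun q : (κ × S) × ι => blk q.1.2) Q (fun a a' => κQb * Real.exp (-(δ₀ * g.dist a a'))))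
    (hQsb : HasMajorant (g := toB6 g Rr H) (fun q : (κ × S) × ι => blk q.1.2) Qs (fun a a' => κQb * Real.exp (-(δ₀ * g.dist a a'))))
    (ha324 : HasMajorant (g := toB6 g Rr H) (fun q : (κ × S) × ι => blk q.1.2) a
      (fun a a' : g.Site => if a = a' then abar * (g.len a ^ 2)⁻¹ else 0))
    -- THEOREM 3.3 for `G(U)`: two-sided inverse of the concrete `Δ_a(U)` and its (3.42)-entries at the rate `δ₀`
    (hΔG : deltaA (conj b (lapDDLetter T ((g.eta : ℂ)⁻¹) U)) (conj b (dPrimeLetter T U g.eta))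
      (conjHom b (gradLin T ((g.eta : ℂ)⁻¹) U) ∘ₗ (1 - (Gp ∘ₗ Qcs ∘ₗ Linv ∘ₗ Qc ∘ₗ Gp)) ∘ₗ conjHom b (divLin T ((g.eta : ℂ)⁻¹) U)) Qs a Q * G = 1)
    (hGΔ : G * deltaA (conj b (lapDDLetter T ((g.eta : ℂ)⁻¹) U)) (conj b (dPrimeLetter T U g.eta))
      (conjHom b (gradLin T ((g.eta : ℂ)⁻¹) U) ∘ₗ (1 - (Gp ∘ₗ Qcs ∘ₗ Linv ∘ₗ Qc ∘ₗ Gp)) ∘ₗ conjHom b (divLin T ((g.eta : ℂ)⁻¹) U)) Qs a Q = 1)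
    (hG : HasMajorant (g := toB6 g Rr H) (fun q : (κ × S) × ι => blk q.1.2) G
      (fun a a' => B₀ * g.len a ^ 2 * Real.exp (-(δ₀ * g.dist a a'))))
    (hDG : ∀ k : κ ⊕ κ, HasMajorant (g := toB6 g Rr H) (fun q : (κ × S) × ι => blk q.1.2)
      (conj b (diffLetter (bT T) (bU U) ((g.eta : ℂ)⁻¹) k) * G) (fun a a' => B₀ * g.len a * Real.exp (-(δ₀ * g.dist a a'))))
    (hGD : ∀ k : κ ⊕ κ, HasMajorant (g := toB6 g Rr H) (fun q : (κ × S) × ι => blk q.1.2)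
      (G * conj b (diffLetter (bT T) (bU U) ((g.eta : ℂ)⁻¹) k)) (fun a a' => B₀ * g.len a * Real.exp (-(δ₀ * g.dist a a')))),
    ∀ (α₁ : ℝ), 0 ≤ α₁ → α₁ ≤ a₁ →
    -- the exponent field `A` in the domain (3.37), read blockwise in the shapes of FILES 1–19, and the `A`-dependent (3.59) data `kF`, `sF`
    ∀ (A : κ → S → 𝔸) (kF : g.Site → S → 𝔸 →L[ℝ] 𝔸) (sF : S → 𝔸 →L[ℝ] 𝔸),
      (∀ y x, blk x = y → ‖kF y x‖ ≤ Cq * α₁ * w y) → (∀ x, ‖sF x‖ ≤ Cq * α₁) →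
      (∀ ν k x, ‖((g.eta : ℂ)⁻¹) • covDstar T U ν (A k) x‖ ≤ α₁ * (g.len (blk x) ^ 2)⁻¹) →
      (∀ μ ν x, ‖((g.eta : ℂ)⁻¹) • covD T U μ (A ν) x‖ ≤ α₁ * (g.len (blk x) ^ 2)⁻¹) →
      (∀ μ ν x, ‖((g.eta : ℂ)⁻¹) • covDstar T U ν (A ν) (T μ x)‖ ≤ α₁ * (g.len (blk x) ^ 2)⁻¹) →
      (∀ μ x, ‖((g.eta : ℂ)⁻¹) • covDstar T U μ (tauB T U μ (A μ)) x‖ ≤ α₁ * (g.len (blk x) ^ 2)⁻¹) →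
      (∀ μ ν k x, ‖((g.eta : ℂ)⁻¹) • covD T U μ (A k) ((T ν).symm x)‖ ≤ α₁ * (g.len (blk x) ^ 2)⁻¹) →
      (∀ k x, ‖A k x‖ ≤ α₁ * (g.len (blk x))⁻¹) → (∀ ν k x, ‖tauB T U ν (A k) x‖ ≤ α₁ * (g.len (blk x))⁻¹) →
      (∀ μ k x, ‖tauF T U μ (A k) x‖ ≤ α₁ * (g.len (blk x))⁻¹) →
      (∀ k μ ν x, ‖A k ((T ν).symm (T μ x))‖ ≤ α₁ * (g.len (blk x))⁻¹) →
      (∀ μ x m z, (m, z) ∈ stBonds T μ x → ‖A m z‖ ≤ α₁ * (g.len (blk x))⁻¹) →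
      (∀ μ x m z, (m, z) ∈ B9Eq375Locality.locBondsA T μ x → ‖A m z‖ ≤ α₁ * (g.len (blk x))⁻¹) →
      (∀ μ x m n y, Through T μ x m n y →
        ‖covD T U m (A n) y‖ ≤ g.eta * (α₁ * ((g.len (blk x))⁻¹) ^ 2) ∧ ‖covD T U n (A m) y‖ ≤ g.eta * (α₁ * ((g.len (blk x))⁻¹) ^ 2)) →
    -- the (3.57)/(3.59) letters `F′₂(A)`, `F′₂*(A)` (block-local, size `c_F α₁`)
    ∀ {Qc' Fc : (S × ι → ℝ) →ₗ[ℝ] (g.Site → ℝ)} {Qcs' Fcs : (g.Site → ℝ) →ₗ[ℝ] (S × ι → ℝ)},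
      Qc' = Qc + Fc → Qcs' = Qcs + Fcs →
      HasMajorantHom (g := toB6 g Rr H) (fun p : S × ι => blk p.1) (fun y : g.Site => y) Fc
        (fun a a' : g.Site => cF * α₁ * (if a = a' then (1 : ℝ) else 0)) →
      HasMajorantHom (g := toB6 g Rr H) (fun y : g.Site => y) (fun p : S × ι => blk p.1) Fcs
        (fun a a' : g.Site => cF * α₁ * (if a = a' then (1 : ℝ) else 0)) →
    -- the (3.80)–(3.81) letters `F₂(A)`, `F₂*(A)` («|F₂(A)|, |F₂*(A)| ≦ O(1)α₁»), `P₂(A)` of (3.82)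
    ∀ {P₂ Qs' Q' F₂ F₂s : Module.End ℝ ((κ × S) × ι → ℝ)},
      Q' = Q + F₂ → Qs' = Qs + F₂s → P₂ = pTwo Qs Q F₂ F₂s a →
      HasMajorant (g := toB6 g Rr H) (fun q : (κ × S) × ι => blk q.1.2) F₂ (fun a a' => cFb * α₁ * Real.exp (-(δ₀ * g.dist a a'))) →
      HasMajorant (g := toB6 g Rr H) (fun q : (κ × S) × ι => blk q.1.2) F₂s (fun a a' => cFb * α₁ * Real.exp (-(δ₀ * g.dist a a'))) →
    ∃ (Tinv : Module.End ℝ (g.Site → ℝ)) (GExt : Module.End ℝ ((κ × S) × ι → ℝ)),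
      Tinv * (Qc' ∘ₗ ((gPrimeExtEnd Gp (conj b (vPrimeConc T U g.eta A blk kQ kF sQ sF cfun) * Gp)) * (gPrimeExtEnd Gp (conj b (vPrimeConc T U g.eta A blk kQ kF sQ sF cfun) * Gp))) ∘ₗ Qcs') = 1 ∧
      (Qc' ∘ₗ ((gPrimeExtEnd Gp (conj b (vPrimeConc T U g.eta A blk kQ kF sQ sF cfun) * Gp)) * (gPrimeExtEnd Gp (conj b (vPrimeConc T U g.eta A blk kQ kF sQ sF cfun) * Gp))) ∘ₗ Qcs') * Tinv = 1 ∧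
      deltaA (conj b (lapDDLetter T ((g.eta : ℂ)⁻¹) (prodCfg U g.eta A)))
          (conj b (dPrimeLetter T (prodCfg U g.eta A) g.eta))
          (conjHom b (gradLin T ((g.eta : ℂ)⁻¹) (prodCfg U g.eta A)) ∘ₗ (1 - ((Gp ∘ₗ Qcs ∘ₗ Linv ∘ₗ Qc ∘ₗ Gp) + (B9Eq360Vprime.pPrime Gp (gPrimeExtEnd Gp (conj b (vPrimeConc T U g.eta A blk kQ kF sQ sF cfun) * Gp)) (Qcs ∘ₗ secRes rep) (Qcs' ∘ₗ secRes rep) (secConj rep Linv) (secConj rep Tinv) (secExt rep ∘ₗ Qc) (secExt rep ∘ₗ Qc'))))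
            ∘ₗ conjHom b (divLin T ((g.eta : ℂ)⁻¹) (prodCfg U g.eta A))) Qs' a Q' * GExt = 1 ∧
      GExt *
      deltaA (conj b (lapDDLetter T ((g.eta : ℂ)⁻¹) (prodCfg U g.eta A)))
          (conj b (dPrimeLetter T (prodCfg U g.eta A) g.eta))
          (conjHom b (gradLin T ((g.eta : ℂ)⁻¹) (prodCfg U g.eta A)) ∘ₗ (1 - ((Gp ∘ₗ Qcs ∘ₗ Linv ∘ₗ Qc ∘ₗ Gp) + (B9Eq360Vprime.pPrime Gp (gPrimeExtEnd Gp (conj b (vPrimeConc T U g.eta A blk kQ kF sQ sF cfun) * Gp)) (Qcs ∘ₗ secRes rep) (Qcs' ∘ₗ secRes rep) (secConj rep Linv) (secConj rep Tinv) (secExt rep ∘ₗ Qc) (secExt rep ∘ₗ Qc'))))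
            ∘ₗ conjHom b (divLin T ((g.eta : ℂ)⁻¹) (prodCfg U g.eta A))) Qs' a Q' = 1 ∧
      (∀ (X : Module.End ℝ ((κ × S) × ι → ℝ)) (P : g.Site → ℝ), (∀ y, 0 ≤ P y) →
        HasMajorant (g := toB6 g Rr H) (fun q : (κ × S) × ι => blk q.1.2) (X * G)
          (fun a a' => B₀ * P a * Real.exp (-(δ₀ * g.dist a a'))) →
        HasMajorant (g := toB6 g Rr H) (fun q : (κ × S) × ι => blk q.1.2) (X * GExt)
          (fun a a' => B * P a * Real.exp (-(δ₀ / 6 * g.dist a a')))) ∧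
      (∀ Y : Module.End ℝ ((κ × S) × ι → ℝ),
        HasMajorant (g := toB6 g Rr H) (fun q : (κ × S) × ι => blk q.1.2) (G * Y)
          (fun a a' => B₀ * g.len a * Real.exp (-(δ₀ * g.dist a a'))) →
        HasMajorant (g := toB6 g Rr H) (fun q : (κ × S) × ι => blk q.1.2) (GExt * Y)
          (fun a a' => B * g.len a * Real.exp (-(δ₀ / 6 * g.dist a a')))) ∧
      -- (iii) the (3.43)-type Hölder members of THIS `G(U′U)` with the derivative (any left letter `D`) ON THE LEFT, per probe (`norm_probe_transfer` on the left clause)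
      (∀ (D : Module.End ℝ ((κ × S) × ι → ℝ)) (Φ : (κ × S → 𝔸) →ₗ[ℝ] 𝔸) (y : g.Site) (p₀ : (κ × S) × ι), blk p₀.1.2 = y →
        ∀ (β Bh cζ : ℝ), 0 ≤ Bh → 0 ≤ cζ →
        (∀ (y' : g.Site) (μ : (κ × S) × ι → ℝ) (M : ℝ), BlockSupp (g := toB6 g Rr H) (fun q : (κ × S) × ι => blk q.1.2) μ y' M →
          ‖Φ ((coordEquiv b).symm (D (G μ)))‖ ≤ Bh * g.len y ^ (1 - β) * cζ * Real.exp (-(δ₀ * g.dist y y')) * M) →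
        ∀ (y' : g.Site) (μ : (κ × S) × ι → ℝ) (M : ℝ), BlockSupp (g := toB6 g Rr H) (fun q : (κ × S) × ι => blk q.1.2) μ y' M →
          ‖Φ ((coordEquiv b).symm (D (GExt μ)))‖ ≤
            B * Bh * g.len y ^ (1 - β) * cζ * Real.exp (-(δ₀ / 6 * g.dist y y')) * M) ∧
      -- (iv) NEW: Theorem 3.3's (3.43)-type member of THIS `G(U′U)` WITH THE DERIVATIVE (any right letter `D_s` with a (3.42)₃-type entry) ON THE RIGHT
      (∀ (Ds : Module.End ℝ ((κ × S) × ι → ℝ)),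
        HasMajorant (g := toB6 g Rr H) (fun q : (κ × S) × ι => blk q.1.2) (G * Ds) (fun a a' => B₀ * g.len a * Real.exp (-(δ₀ * g.dist a a'))) →
      ∀ (Φ : (κ × S → 𝔸) →ₗ[ℝ] 𝔸) (y : g.Site) (p₀ : (κ × S) × ι), blk p₀.1.2 = y →
      ∀ (γ Bh cζ : ℝ), 0 ≤ Bh → 0 ≤ cζ →
        -- (a) the (3.40) quotient of `ζG(U)J` itself (from (3.42)₂ in print; an input here)
        (∀ (y' : g.Site) (μ : (κ × S) × ι → ℝ) (M : ℝ), BlockSupp (g := toB6 g Rr H) (fun q : (κ × S) × ι => blk q.1.2) μ y' M →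
          ‖Φ ((coordEquiv b).symm (G μ))‖ ≤ Bh * g.len y ^ (2 - γ) * cζ * Real.exp (-(δ₀ * g.dist y y')) * M) →
        -- (b) the member «‖ζG(U)∇_kJ‖_β» for every concrete difference letter
        (∀ (k : κ ⊕ κ) (y' : g.Site) (μ : (κ × S) × ι → ℝ) (M : ℝ), BlockSupp (g := toB6 g Rr H) (fun q : (κ × S) × ι => blk q.1.2) μ y' M →
          ‖Φ ((coordEquiv b).symm ((G * conj b (diffLetter (bT T) (bU U) ((g.eta : ℂ)⁻¹) k)) μ))‖ ≤
            Bh * g.len y ^ (1 - γ) * cζ * Real.exp (-(δ₀ * g.dist y y')) * M) →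
        -- (c) the member for the right letter `D_s`
        (∀ (y' : g.Site) (μ : (κ × S) × ι → ℝ) (M : ℝ), BlockSupp (g := toB6 g Rr H) (fun q : (κ × S) × ι => blk q.1.2) μ y' M →
          ‖Φ ((coordEquiv b).symm ((G * Ds) μ))‖ ≤ Bh * g.len y ^ (1 - γ) * cζ * Real.exp (-(δ₀ * g.dist y y')) * M) →
        ∀ (y' : g.Site) (μ : (κ × S) × ι → ℝ) (M : ℝ), BlockSupp (g := toB6 g Rr H) (fun q : (κ × S) × ι => blk q.1.2) μ y' M →
          ‖Φ ((coordEquiv b).symm ((GExt * Ds) μ))‖ ≤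
            B * Bh * g.len y ^ (1 - γ) * cζ * Real.exp (-(δ₀ / 6 * g.dist y y')) * M) := by
  classical
  have hSb : 0 ≤ ∑ i, ‖b i‖ := Finset.sum_nonneg fun i _ => norm_nonneg _
  -- the scale-transfer constants of the chain, READ FROM THE GIVEN FUNCTION `Λf` (lattice-free)
  have hΛ : 1 ≤ Λf (1 / 100) := hΛf _ (by norm_num)
  have hΛρ1 : 1 ≤ Λf (1 / 100 * (9 / 50)) := hΛf _ (by norm_num)
  -- r06's KERNEL-FREE uniform G-clause (R1) and (3.77) with the printed quantifiers (R1 twin of FILE 47 §2) — BEFORE THE LATTICE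
  obtain ⟨a₁, ha₁, B', hB', H28⟩ := thm34_G_clause_uniform b κ d δ₀ B₀ κQ BG B₁ cF Cq a₀ C₀ d₀ M₂ κQb cFb abar Λf hB₀ hκQ hBG hB₁ hcF hCq ha₀
    hC₀ hM₂ hδ₀ hκQb hcFb habar hΛf hrepr
  obtain ⟨a₂, ha₂, K, hK, H2⟩ := exists_threshold_pOne_uniform b κ d δ₀ κQ BG B₁ cF Cq a₀ d₀ M₂ Λf hκQ hBG hB₁ hcF hCq ha₀ hM₂ hδ₀ hΛf hrepr
  -- the geometry of FILE 20's `G`-side cascade: exponents `1/100`, letters at the rate `δ₀/5`, composites at `9δ₀/50`, target `δ₀/6`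
  have hΛ0 : 0 ≤ (Λf (1 / 100)) := zero_le_one.trans hΛ
  have hΛρ : 0 ≤ (Λf (1 / 100 * (9 / 50))) := zero_le_one.trans hΛρ1
  have hδ5 : (0 : ℝ) ≤ 1 / 5 * δ₀ := by linarith only [hδ₀]
  have hρ0 : (0 : ℝ) ≤ 9 / 50 * δ₀ := by linarith only [hδ₀]
  have hr : 9 / 50 * δ₀ + (1 / 100 + 1 / 100) * δ₀ ≤ 1 / 5 * δ₀ := by linarith only [hδ₀]
  have hrP : 1 / 5 * δ₀ + (1 / 100 + 1 / 100) * δ₀ ≤ δ₀ := by linarith only [hδ₀]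
  have h15 : 1 / 5 * δ₀ ≤ δ₀ := by linarith only [hδ₀]
  have hα'ρ0 : (0 : ℝ) ≤ 1 / 100 * (9 / 50 * δ₀) := by linarith only [hδ₀]
  have hα'ρ2 : (0 : ℝ) ≤ (1 - 2 * (1 / 100)) * (9 / 50 * δ₀) := by linarith only [hδ₀]
  have hρ₃ : (0 : ℝ) ≤ δ₀ / 6 := by linarith only [hδ₀]
  have hρ₃' : δ₀ / 6 ≤ (1 - 3 * (1 / 100)) * (9 / 50 * δ₀) := by linarith only [hδ₀]
  -- «for α₁ sufficiently small» (pp. 402, 407): the smallness function of (3.85)–(3.86) at this cascade is continuous at `α₁ = 0` and vanishes there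
  obtain ⟨ε, hε, hF⟩ := exists_threshold_of_continuousAt
    (f := fun α₁ : ℝ => (kappa385 B₀ (cV385 (Fintype.card κ) α₁ C₀ (M₂ * (∑ i, ‖b i‖) * Real.exp (1 / 5 * δ₀ * d₀))
            + ∑ _k ∈ (Finset.univ : Finset (κ ⊕ κ)), (10 + 8 * Fintype.card κ + (16 * Fintype.card κ + 12) * C₀) * (M₂ * (∑ i, ‖b i‖) * Real.exp (1 / 5 * δ₀ * d₀))) K (kappa383 κQb cFb abar (Λf (1 / 100)) (B6.c1 d δ₀ (1 / 100)) α₁) (Λf (1 / 100)) (B6.c1 d δ₀ (1 / 100)) * α₁ * B6.c1 d (9 / 50 * δ₀) (1 / 100)))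
    (by
      unfold kappa385 kappa383 cV385 B9Eq382V3Letters.cV0 B9Eq373V3.kΔ B9Eq373V3.kP
      fun_prop)
    (by simp)
  -- «of course with different constants» (p. 403): the clause constant of FILE 35 at this cascade is continuous at `α₁ = 0`, hence bounded below a threshold
  obtain ⟨KB, εB, hKB, hεB, hFB⟩ := exists_bound_of_continuousAt
    (f := fun α₁ : ℝ => ((∑ i, ‖b i‖) * M₂ * (1 + kappa385 1 (cV385 (Fintype.card κ) α₁ C₀ (M₂ * (∑ i, ‖b i‖) * Real.exp (1 / 5 * δ₀ * d₀))
            + ∑ _k ∈ (Finset.univ : Finset (κ ⊕ κ)), (10 + 8 * Fintype.card κ + (16 * Fintype.card κ + 12) * C₀) * (M₂ * (∑ i, ‖b i‖) * Real.exp (1 / 5 * δ₀ * d₀))) K (kappa383 κQb cFb abar (Λf (1 / 100)) (B6.c1 d δ₀ (1 / 100)) α₁) (Λf (1 / 100)) (B6.c1 d δ₀ (1 / 100)) * α₁ * (B₀ * (Λf (1 / 100 * (9 / 50))) ^ 2 * B6.c1 d (9 / 50 * δ₀) (1 / 100) * (1 - (kappa385 B₀ (cV385 (Fintype.card κ) α₁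 C₀ (M₂ * (∑ i, ‖b i‖) * Real.exp (1 / 5 * δ₀ * d₀))
            + ∑ _k ∈ (Finset.univ : Finset (κ ⊕ κ)), (10 + 8 * Fintype.card κ + (16 * Fintype.card κ + 12) * C₀) * (M₂ * (∑ i, ‖b i‖) * Real.exp (1 / 5 * δ₀ * d₀))) K (kappa383 κQb cFb abar (Λf (1 / 100)) (B6.c1 d δ₀ (1 / 100)) α₁) (Λf (1 / 100)) (B6.c1 d δ₀ (1 / 100)) * α₁ * B6.c1 d (9 / 50 * δ₀) (1 / 100)))⁻¹) * (Λf (1 / 100 * (9 / 50))) * B6.c1 d (9 / 50 * δ₀) (1 / 100))))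
    (by
      unfold kappa385 kappa383 cV385 B9Eq382V3Letters.cV0 B9Eq373V3.kΔ B9Eq373V3.kP
      fun_prop (disch := simp))
  -- ONE threshold, ONE constant (clause constant `B'`, Hölder-left constant `(Σ‖b_i‖)M₂B'/B₀`, Hölder-right constant `K_B`)
  have hBL : 0 ≤ (∑ i, ‖b i‖) * M₂ * (B' / B₀) := mul_nonneg (mul_nonneg hSb hM₂) (div_nonneg hB' hB₀'.le)
  have hBtot : 0 ≤ B' + (∑ i, ‖b i‖) * M₂ * (B' / B₀) + KB := add_nonneg (add_nonneg hB' hBL) hKB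
  refine ⟨min (min (min a₁ a₂) (1 / 4)) (min (ε / 2) (εB / 2)),
    lt_min (lt_min (lt_min ha₁ ha₂) (by norm_num)) (lt_min (half_pos hε) (half_pos hεB)), B' + (∑ i, ‖b i‖) * M₂ * (B' / B₀) + KB, hBtot, ?_⟩
  -- NOW the lattice, the background, the data, the Theorems-for-`U` inputs (block members only — NO kernel-form letters); then `α₁`, `A` and the `A`-letters
  intro S _ _ T U g _ _ _ Rr H blk kQ sQ cfun w hdnn htri hrefl hsym hlen hlenη hη hL h261 hST hT hU1 h35 hd₀B hd₀F hd₀FB hd₀st hd₀loc hd₀0 hw hcard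
    hkQ hsQ hcfun Gp h342_1 h342_2 h342_3 rep hrep Qc Qcs Linv hQc hQcs hLinv h348 G Qs Q a hQb hQsb ha324 hΔG hGΔ hG hDG hGD α₁ hα₁0 hα₁1 A kF sF
    hkF hsF h337B h337F h337B' h337Bτ h337FB hA hAτB hAτF hAFB hAst hAloc hdAst Qc' Fc Qcs' Fcs h357 h357s hFc hFcs P₂ Qs' Q' F₂ F₂s h380 h380s
    hP₂def hF₂ hF₂s
  obtain ⟨y₀⟩ := ‹Nonempty g.Site›
  replace H28 := H28 T U blk kQ sQ cfun w hdnn htri hrefl hsym hlen hlenη hη hL h261 hST hT hU1 h35 hd₀B hd₀F hd₀FB hd₀st hd₀loc hd₀0 hw hcard hkQ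
    hsQ hcfun h342_1 h342_2 h342_3 rep hrep hQc hQcs hLinv h348 hQb hQsb ha324 hΔG hGΔ hG hDG hGD
  replace H2 := H2 T U blk kQ sQ cfun w hdnn htri hrefl hsym hlen hlenη hη h261 hST hU1 hd₀B hd₀F hd₀0 hw hcard hkQ hsQ hcfun h342_1 h342_2 h342_3
    rep hrep hQc hQcs hLinv h348
  obtain ⟨hT1, hT2, hT1i, hT2i, -, -⟩ := hST (1 / 100) (by norm_num)
  obtain ⟨hTρ0, -, -, -, -, -⟩ := hST (1 / 100 * (9 / 50)) (by norm_num)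
  have hTρ : ScaleTransfer g (9 / 50 * δ₀) (1 / 100) (Λf (1 / 100 * (9 / 50))) (fun a => g.len a) := scaleTransfer_rescale hTρ0
  have h261β : Ineq261 d (toB6 g Rr H) δ₀ (1 / 100) := h261 _ (by norm_num) (by norm_num)
  have h261' : Ineq261 d (toB6 g Rr H) (9 / 50 * δ₀) (1 / 100) :=
    ineq261_rescale (h261 (1 / 100 * (9 / 50)) (by norm_num) (by norm_num))
  have hc₂ : 0 < B6.c1 d δ₀ (1 / 100) := c1_pos_of_ineq261 h261β y₀ (hrefl y₀)
  have hm₁ : min (min (min a₁ a₂) (1 / 4)) (min (ε / 2) (εB / 2)) ≤ a₁ :=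
    (min_le_left _ _).trans ((min_le_left _ _).trans (min_le_left _ _))
  have hm₂ : min (min (min a₁ a₂) (1 / 4)) (min (ε / 2) (εB / 2)) ≤ a₂ :=
    (min_le_left _ _).trans ((min_le_left _ _).trans (min_le_right _ _))
  have hmq : min (min (min a₁ a₂) (1 / 4)) (min (ε / 2) (εB / 2)) ≤ 1 / 4 := (min_le_left _ _).trans (min_le_right _ _)
  have hmε : min (min (min a₁ a₂) (1 / 4)) (min (ε / 2) (εB / 2)) ≤ ε / 2 := (min_le_right _ _).trans (min_le_left _ _)
  have hmεB : min (min (min a₁ a₂) (1 / 4)) (min (ε / 2) (εB / 2)) ≤ εB / 2 := (min_le_right _ _).trans (min_le_right _ _)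
  have hα₁a : α₁ ≤ a₁ := hα₁1.trans hm₁
  have hα₁b : α₁ ≤ a₂ := hα₁1.trans hm₂
  have hα₁q : α₁ ≤ 1 / 4 := hα₁1.trans hmq
  have habs : |α₁| = α₁ := abs_of_nonneg hα₁0
  have hα₁ε : |α₁| < ε := by rw [habs]; linarith only [hα₁1, hmε, hε]
  have hα₁εB : |α₁| < εB := by rw [habs]; linarith only [hα₁1, hmεB, hεB]
  -- the kernel-free clause at this `α₁`, `A`: `C⁻¹(U′U)`, `G(U′U)`, identities, the left- and right-entry clauses
  obtain ⟨Tinv, GExt, e1, e2, e3, e4, hGL, hGR⟩ := H28 α₁ hα₁0 hα₁a A kF sF hkF hsF h337B h337F h337B' h337Bτ h337FB hA hAτB hAτF hAFB hAst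
    hAloc hdAst h357 h357s hFc hFcs h380 h380s hP₂def hF₂ hF₂s
  -- (3.77) at this `α₁`, `A`: ITS `C⁻¹(U′U)` coincides with the clause's (uniqueness of the two-sided inverse), so (3.77) holds for the clause's `P₁(A)`
  obtain ⟨Tinv₂, f1, -, hP₁⟩ := H2 α₁ hα₁0 hα₁b A kF sF hkF hsF h337B h337F h337Bτ hA hAτB h357 h357s hFc hFcs
  have hTT : Tinv₂ = Tinv := left_inv_eq_right_inv f1 e2
  rw [hTT] at hP₁
  -- common non-negativities and the weakened constants
  have hw1 : ∀ a : g.Site, 0 ≤ g.len a := fun a => (hlen a).le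
  have hw2 : ∀ a : g.Site, 0 ≤ g.len a ^ 2 := fun a => sq_nonneg _
  have hB'le : B' ≤ B' + (∑ i, ‖b i‖) * M₂ * (B' / B₀) + KB := by linarith only [hBL, hKB]
  have hBLle : (∑ i, ‖b i‖) * M₂ * (B' / B₀) ≤ B' + (∑ i, ‖b i‖) * M₂ * (B' / B₀) + KB := by linarith only [hB', hKB]
  have hKBle : KB ≤ B' + (∑ i, ‖b i‖) * M₂ * (B' / B₀) + KB := by linarith only [hB', hBL]
  refine ⟨Tinv, GExt, e1, e2, e3, e4, ?_, ?_, ?_, ?_⟩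
  · -- (L) the left-entry clause, constant weakened
    intro X P hP hX
    exact hasMajorant_mono _ (hGL X P hP hX) fun a' _ =>
      mul_le_mul_of_nonneg_right (mul_le_mul_of_nonneg_right hB'le (hP a')) (Real.exp_nonneg _)
  · -- (R) the right-entry clause, constant weakened
    intro Y hY
    exact hasMajorant_mono _ (hGR Y hY) fun a' _ =>
      mul_le_mul_of_nonneg_right (mul_le_mul_of_nonneg_right hB'le (hw1 a')) (Real.exp_nonneg _)
  · -- (iii) the Hölder-left members of `G(U′U)` per probe: `norm_probe_transfer` on the left-entry clause (NO kernel letter), constant weakened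
    intro D Φ y p₀ hp₀ β Bh cζ hBh hcζ hhyp y' μ M hμ
    have hc : 0 ≤ Bh * g.len y ^ (1 - β) * cζ := mul_nonneg (mul_nonneg hBh (Real.rpow_nonneg (hlen y).le _)) hcζ
    have key := norm_probe_transfer b (G := toB6 g Rr H) (fun q : (κ × S) × ι => blk q.1.2) (G₁ := G) (G₂ := GExt)
      (E₁ := fun a a' => Real.exp (-(δ₀ * g.dist a a'))) (E₂ := fun a a' => Real.exp (-(δ₀ / 6 * g.dist a a')))
      hB₀' hM₂ (fun a a' => Real.exp_nonneg _) hrepr hGL D Φ p₀ hc (fun z ν C hν => by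
        have h1 := hhyp z ν C hν
        rw [show g.dist y z = g.dist (blk p₀.1.2) z by rw [hp₀]] at h1
        simpa only [mul_assoc] using h1) y' μ M hμ
    rw [hp₀] at key
    have key' : ‖Φ ((coordEquiv b).symm (D (GExt μ)))‖ ≤
        (∑ i, ‖b i‖) * M₂ * (B' / B₀) * Bh * g.len y ^ (1 - β) * cζ * Real.exp (-(δ₀ / 6 * g.dist y y')) * M := by
      refine key.trans (le_of_eq ?_)
      ring
    exact holderBound_const_mono hBLle hBh (Real.rpow_nonneg (hlen y).le _) hcζ (Real.exp_nonneg _) hμ.nonneg key'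
  · -- (iv) NEW: the Hölder-right member of THIS `G(U′U)` — FILE 35 at FILE 20's cascade, then uniqueness of the two-sided inverse
    intro Ds hGDs Φ y p₀ hp₀ γ Bh cζ hBh hcζ h0 hRk hD y' μ M hμ
    -- «η·α₁(Lʲη)⁻¹ ≦ 1/4» from `α₁ ≦ 1/4` and `η ≦ Lʲη`
    have hsmall : ∀ z : g.Site, g.eta * (α₁ * (g.len z)⁻¹) ≤ 1 / 4 := fun z => by
      have hq : g.eta * (g.len z)⁻¹ ≤ 1 := by
        rw [← div_eq_mul_inv]; exact (div_le_one (hlen z)).mpr (hlenη z)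
      calc g.eta * (α₁ * (g.len z)⁻¹) = α₁ * (g.eta * (g.len z)⁻¹) := by ring
        _ ≤ α₁ * 1 := mul_le_mul_of_nonneg_left hq hα₁0
        _ ≤ 1 / 4 := by linarith only [hα₁q]
    have hκ₂ : 0 ≤ (kappa383 κQb cFb abar (Λf (1 / 100)) (B6.c1 d δ₀ (1 / 100)) α₁) := kappa383_nonneg hκQb hcFb habar hΛ0 hc₂.le hα₁0
    -- (3.83) for the printed `P₂(A)` at the rate `δ₀/5`
    have hP₂ : HasMajorant (g := toB6 g Rr H) (fun q : (κ × S) × ι => blk q.1.2) P₂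
        (fun a a' => (kappa383 κQb cFb abar (Λf (1 / 100)) (B6.c1 d δ₀ (1 / 100)) α₁) * α₁ * (g.len a ^ 2)⁻¹ * Real.exp (-(1 / 5 * δ₀ * g.dist a a'))) := by
      rw [hP₂def]
      exact ineq383_op (R := Rr) (H := H) (fun q : (κ × S) × ι => blk q.1.2) d δ₀ δ₀ (1 / 100) (1 / 100) (1 / 5 * δ₀) (Λf (1 / 100)) κQb cFb abar α₁ hκQb hcFb habar hα₁0 hΛ0
        hδ5 (by norm_num) (by norm_num) hδ₀.le hrP hdnn htri h261β hT2i hQb hQsb hF₂ hF₂s ha324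
    -- Theorem 3.3's letters for `U` weakened to the rate `δ₀/5`
    have hG5 := hasMajorant_rate_mono (R := Rr) (H := H) (fun q : (κ × S) × ι => blk q.1.2) B₀ (fun a => g.len a ^ 2) hB₀ hw2 h15 hdnn hG
    have hDG5 := fun k : κ ⊕ κ => hasMajorant_rate_mono (R := Rr) (H := H) (fun q : (κ × S) × ι => blk q.1.2) B₀ (fun a => g.len a) hB₀ hw1 h15 hdnn (hDG k)
    have hGD5 := fun k : κ ⊕ κ => hasMajorant_rate_mono (R := Rr) (H := H) (fun q : (κ × S) × ι => blk q.1.2) B₀ (fun a => g.len a) hB₀ hw1 h15 hdnn (hGD k)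
    have hGDs5 := hasMajorant_rate_mono (R := Rr) (H := H) (fun q : (κ × S) × ι => blk q.1.2) B₀ (fun a => g.len a) hB₀ hw1 h15 hdnn hGDs
    -- the smallness of (3.85)–(3.86) at this `α₁`
    have hsmall385 : (kappa385 B₀ (cV385 (Fintype.card κ) α₁ C₀ (M₂ * (∑ i, ‖b i‖) * Real.exp (1 / 5 * δ₀ * d₀))
            + ∑ _k ∈ (Finset.univ : Finset (κ ⊕ κ)), (10 + 8 * Fintype.card κ + (16 * Fintype.card κ + 12) * C₀) * (M₂ * (∑ i, ‖b i‖) * Real.exp (1 / 5 * δ₀ * d₀))) K (kappa383 κQb cFb abar (Λf (1 / 100)) (B6.c1 d δ₀ (1 / 100)) α₁) (Λf (1 / 100)) (B6.c1 d δ₀ (1 / 100)) * α₁ * B6.c1 d (9 / 50 * δ₀) (1 / 100)) < 1 := (hF α₁ hα₁ε).trans (by norm_num)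
    -- FILE 35: ONE MORE `G(U′U)` — two-sided inverse of THE SAME concrete `Δ_a(U′U)` — with the Hölder-right clause
    obtain ⟨GExt₂, -, g2, -, -, HRG⟩ := thm34_G_holderRight_concreteV₃ (Rr := Rr) (H := H) b T U blk d
      δ₀ (1 / 5 * δ₀) (1 / 100) (1 / 100) (9 / 50 * δ₀) (1 / 100) (Λf (1 / 100)) (Λf (1 / 100 * (9 / 50))) B₀ K (kappa383 κQb cFb abar (Λf (1 / 100)) (B6.c1 d δ₀ (1 / 100)) α₁) α₁ C₀ d₀ M₂
      hB₀ hK hκ₂ hα₁0 hC₀ hΛ0 hΛρ hρ0 (by norm_num) (by norm_num) hδ₀.le hδ5 hM₂ hr (by norm_num) hα'ρ0 hα'ρ2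
      hdnn htri hrefl hsym hlen h261β h261' hT1 hT2 hT1i hT2i hTρ hsmall385 hrepr hη hL A hT hsmall hU1
      h337B h337F h337B' h337Bτ h337FB hA hAτB hAτF hAFB hAst hAloc hdAst h35 hd₀B hd₀F hd₀FB hd₀st hd₀loc hd₀0
      (eq376_concrete T U b hη.ne' A (Gp ∘ₗ Qcs ∘ₗ Linv ∘ₗ Qc ∘ₗ Gp) (B9Eq360Vprime.pPrime Gp (gPrimeExtEnd Gp (conj b (vPrimeConc T U g.eta A blk kQ kF sQ sF cfun) * Gp)) (Qcs ∘ₗ secRes rep) (Qcs' ∘ₗ secRes rep) (secConj rep Linv) (secConj rep Tinv) (secExt rep ∘ₗ Qc) (secExt rep ∘ₗ Qc')))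
      h380 h380s hP₂def hΔG hGΔ hP₁ hP₂ hG5 hDG5 hGD5 hGDs5 (δ₀ / 6) hρ₃ hρ₃'
    have hGG : GExt₂ = GExt := left_inv_eq_right_inv g2 e3
    rw [hGG] at HRG
    -- the clause of FILE 35 fed with the inputs (a)–(c) read at the slower rate `δ₀/5`, then the constant bounded by `K_B ≦ B`
    have hℓ : 0 ≤ g.len y := (hlen y).le
    have key := HRG Φ y p₀ hp₀ γ Bh cζ hBh hcζ
      (fun z ν C hν => holderBound_rate_mono h15 (hdnn y z) hBh (Real.rpow_nonneg hℓ _) hcζ hν.nonneg (h0 z ν C hν))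
      (fun k z ν C hν => holderBound_rate_mono h15 (hdnn y z) hBh (Real.rpow_nonneg hℓ _) hcζ hν.nonneg (hRk k z ν C hν))
      (fun z ν C hν => holderBound_rate_mono h15 (hdnn y z) hBh (Real.rpow_nonneg hℓ _) hcζ hν.nonneg (hD z ν C hν)) y' μ M hμ
    exact holderBound_const_mono ((hFB α₁ hα₁εB).trans hKBle) hBh (Real.rpow_nonneg hℓ _) hcζ (Real.exp_nonneg _) hμ.nonneg key

end HolderGClauseU

end Literature.MathematicalPhysics.QuantumFieldTheory.Balaban1983to89.B9Thm34HolderGClauseUniformR1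

end
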